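import Summits.CriticalPhenomena.CardyFormulaZ2.Theses.CardySelfRefinement
import Summits.CriticalPhenomena.CardyFormulaZ2.Theorems.CardySelfRefinementLagHandOffDiscretisableForcing
import Summits.CriticalPhenomena.CardyFormulaZ2.Theorems.CardySelfRefinementLagHandOffDiscretisableArcs
import Literature.Probability.LatticeModels.DobrushinDiscretisation
import Literature.Probability.RandomPlanarGeometry.ExteriorULC
import Literature.Probability.RandomPlanarGeometry.MarkedDomainCorners
import HarnessLib

/-!
# From a marker-free labelling of the discrete boundary to a `ZdDiscretisationFamily`: partial helper for stub `stub_discretisable` of line `crosscut-dictionary` for crux `LagHandOff` (stmt-CriticalPhenomena-10268)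

The reduction of `stub_discretisable` (`∀ D : DobrushinDomain, ∃ E, ZdDiscretisationFamily D E`) to a
purely combinatorial-geometric statement about the canonical discrete domains
`meshDomain D.carrier δ`, with NO marker sets left: `zdDiscretisationFamily_of_labelling`.  If, for
all small meshes, the square-lattice boundary `zdBoundary` (which depends on `Ω, δ` only) splits as
`SA δ ⊔ SB δ` with

* (sides)   `SA δ` within `ε δ → 0` of the arc `(ab)`, `SB δ` within `ε δ` of `(ba)`;
* (no forcing) no disc `B y = closedBall (δy) (infDist (δy) ∂D)`, `y ∈ SA δ`, covered by the discs of
  `SB δ`, and vice versa — by the forcing lemma of `…DiscretisableForcing.lean` this is NECESSARY for any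
  marker realisation;
* (cut)     exactly two edges of `Ω_δ` join `SA δ` to `SB δ`, each a side of exactly one inner face, and
  their midpoints converge to `{a, b}`,

then marker families exist: `A δ :=` one witness point per `A`-site (in its open disc, off the discs of
the `B`-sites; `exists_witness_of_not_closedBall_subset`) plus a finite EXTERIOR `ε`-net of the arc
(`exists_finite_exterior_net`, from `frontier ⊆ closure (exterior)`, i.e. the Jordan curve theorem,
proved in tree), and `zdDiscreteArc_eq_of_markers` shows that the discrete arcs are exactly
`SA δ`, `SB δ`; Hausdorff convergence of the markers follows from (sides).  Everything here is proved;
what is NOT here is the existence of such labellings (the lattice-topological heart of the stub: two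
"good" cut edges on the boundary of the bulk face near `a` and `b`, plus no forcing at the cut).
-/

noncomputable section

open MeasureTheory Filter Set Topology
open scoped BoundedContinuousFunction
open Literature.Probability.Percolation Literature.Probability.LatticeModels
open Literature.Probability.RandomPlanarGeometry Literature.Probability.Percolation.QuadCrossing
open Summit.CriticalPhenomena.CardyFormulaZ2.Theses.CardySelfRefinement

namespace Summit.CriticalPhenomena.CardyFormulaZ2.Cruxes.LagHandOff.CrosscutDictionary

/-! ### Metric preliminaries -/

/-- For an open set, the distance from an inside point to the frontier is at most the distance to
any outside point (an outside point off the closure is strictly farther,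
`infDist_frontier_lt_dist_of_not_mem_closure`). [folklore] -/
theorem infDist_frontier_le_dist_of_not_mem {Ω : Set ℂ} {z q : ℂ} (hz : z ∈ Ω) (hq : q ∉ Ω) :
    Metric.infDist z (frontier Ω) ≤ dist z q := by
  by_cases hqc : q ∈ closure Ω
  · exact Metric.infDist_le_dist_of_mem ⟨hqc, fun h => hq (interior_subset h)⟩
  · exact (infDist_frontier_lt_dist_of_not_mem_closure hz hqc).le

/-- The open disc about a point of a set with radius the distance to the frontier lies inside the
set. [folklore] -/
theorem ball_infDist_frontier_subset {Ω : Set ℂ} {z : ℂ} (hz : z ∈ Ω) :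
    Metric.ball z (Metric.infDist z (frontier Ω)) ⊆ Ω := by
  intro w hw
  by_contra hwΩ
  rw [Metric.mem_ball, dist_comm] at hw
  have := infDist_frontier_le_dist_of_not_mem hz hwΩ
  linarith

/-- **Witness points.** If the disc of the boundary site `y` is not covered by the discs of a finite
set `X` of sites, there is a point of the OPEN disc of `y` (hence a point of the open domain, off
its frontier) lying strictly outside every disc of `X`.  (Take an uncovered point `q` of the closed
disc; the union of the discs of `X` is closed, so a small step from `q` towards the centre stays
uncovered and enters the open disc.) [folklore] -/
theorem exists_witness_of_not_closedBall_subset {Ω : Set ℂ} (hΩ : IsOpen Ω) {δ : ℝ} {y : Site 2}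
    (hy : meshPoint δ y ∈ Ω) (hJ : (frontier Ω).Nonempty) {X : Set (Site 2)} (hX : X.Finite)
    (hcover : ¬ Metric.closedBall (meshPoint δ y) (Metric.infDist (meshPoint δ y) (frontier Ω)) ⊆
      ⋃ x ∈ X, Metric.closedBall (meshPoint δ x) (Metric.infDist (meshPoint δ x) (frontier Ω))) :
    ∃ p ∈ Ω, dist (meshPoint δ y) p < Metric.infDist (meshPoint δ y) (frontier Ω) ∧
      ∀ x ∈ X, Metric.infDist (meshPoint δ x) (frontier Ω) < dist (meshPoint δ x) p := by
  set c := meshPoint δ y with hc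
  set r : ℝ := Metric.infDist c (frontier Ω) with hr
  set K : Set ℂ := ⋃ x ∈ X, Metric.closedBall (meshPoint δ x)
    (Metric.infDist (meshPoint δ x) (frontier Ω)) with hK
  obtain ⟨q, hqB, hqK⟩ := not_subset.1 hcover
  have hrpos : 0 < r :=
    (isClosed_frontier.notMem_iff_infDist_pos hJ).1 fun h => (hΩ.inter_frontier_eq ▸ ⟨hy, h⟩ : c ∈ (∅ : Set ℂ))
  -- `K` is closed, so a neighbourhood of `q` misses it
  have hKc : IsClosed K := by
    refine Set.Finite.isClosed_biUnion hX fun x _ => Metric.isClosed_closedBall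
  obtain ⟨η, hη, hηK⟩ : ∃ η > 0, Metric.ball q η ⊆ Kᶜ :=
    Metric.isOpen_iff.1 hKc.isOpen_compl q hqK
  -- step from `q` towards the centre `c`
  have hqc : dist q c ≤ r := by rw [Metric.mem_closedBall] at hqB; exact hqB
  obtain ⟨t, ht0, ht1, htη⟩ : ∃ t : ℝ, 0 < t ∧ t ≤ 1 ∧ t * r < η := by
    refine ⟨min 1 (η / (2 * r)), lt_min one_pos (by positivity), min_le_left _ _, ?_⟩
    calc min 1 (η / (2 * r)) * r ≤ η / (2 * r) * r :=
          mul_le_mul_of_nonneg_right (min_le_right _ _) hrpos.le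
      _ = η / 2 := by field_simp
      _ < η := by linarith
  set p : ℂ := q + (t : ℂ) * (c - q) with hp
  have hdqp : dist q p = t * dist q c := by
    rw [hp, dist_eq_norm, show q - (q + (t : ℂ) * (c - q)) = -((t : ℂ) * (c - q)) by ring, norm_neg,
      norm_mul, Complex.norm_real, Real.norm_eq_abs, abs_of_pos ht0, dist_comm, dist_eq_norm]
  have hdcp : dist c p = (1 - t) * dist q c := by
    rw [hp, dist_eq_norm, show c - (q + (t : ℂ) * (c - q)) = ((1 - t : ℝ) : ℂ) * (c - q) by
      push_cast; ring, norm_mul, Complex.norm_real, Real.norm_eq_abs, abs_of_nonneg (by linarith),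
      dist_eq_norm, ← norm_neg (q - c), neg_sub]
  have hpball : dist c p < r := by
    rw [hdcp]
    calc (1 - t) * dist q c ≤ (1 - t) * r := mul_le_mul_of_nonneg_left hqc (by linarith)
      _ < r := by nlinarith
  have hpK : p ∉ K := by
    refine hηK ?_
    rw [Metric.mem_ball, dist_comm, hdqp]
    calc t * dist q c ≤ t * r := mul_le_mul_of_nonneg_left hqc ht0.le
      _ < η := htη
  refine ⟨p, ball_infDist_frontier_subset hy (by rw [Metric.mem_ball, dist_comm]; exact hpball),
    hpball, fun x hx => ?_⟩
  by_contra hle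
  push Not at hle
  exact hpK (mem_iUnion₂.2 ⟨x, hx, by rw [Metric.mem_closedBall, dist_comm]; exact hle⟩)

/-- **Exterior nets.** For a Jordan domain `D`, a compact `K ⊆ ∂D` and `ε > 0` there is a finite set
`P` of points OFF the closure of `D` within Hausdorff distance `ε` of `K` (nonempty if `K` is): every
boundary point is a limit of exterior points (`JordanDomain.frontier_subset_closure_exterior'`, from
the Jordan curve theorem), so an `ε/2`-net of `K` can be pushed into the exterior. [folklore] -/
theorem exists_finite_exterior_net (D : JordanDomain) {K : Set ℂ} (hK : IsCompact K)
    (hKJ : K ⊆ frontier D.carrier) {ε : ℝ} (hε : 0 < ε) :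
    ∃ P : Set ℂ, P.Finite ∧ Disjoint P (closure D.carrier) ∧ (K.Nonempty → P.Nonempty) ∧
      Metric.hausdorffEDist P K ≤ ENNReal.ofReal ε := by
  obtain ⟨N, hNK, hNfin, hcov⟩ := hK.finite_cover_balls (e := ε / 2) (by positivity)
  -- push every net point into the exterior
  have hext : ∀ n ∈ N, ∃ q, q ∉ closure D.carrier ∧ dist n q < ε / 2 := by
    intro n hn
    have hn' : n ∈ closure (closure D.carrier)ᶜ := D.frontier_subset_closure_exterior' (hKJ (hNK hn))
    obtain ⟨q, hq, hd⟩ := Metric.mem_closure_iff.1 hn' (ε / 2) (by positivity)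
    exact ⟨q, hq, hd⟩
  choose! f hf using hext
  refine ⟨f '' N, hNfin.image f, ?_, ?_, ?_⟩
  · refine Set.disjoint_left.2 ?_
    rintro _ ⟨n, hn, rfl⟩ h
    exact (hf n hn).1 h
  · rintro ⟨k, hk⟩
    obtain ⟨n, hn, -⟩ : ∃ n ∈ N, k ∈ Metric.ball n (ε / 2) := by
      simpa only [mem_iUnion, exists_prop] using hcov hk
    exact ⟨f n, n, hn, rfl⟩
  · refine Metric.hausdorffEDist_le_of_mem_edist ?_ ?_
    · rintro _ ⟨n, hn, rfl⟩
      refine ⟨n, hNK hn, ?_⟩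
      rw [edist_dist, dist_comm]
      exact ENNReal.ofReal_le_ofReal (by linarith [(hf n hn).2])
    · intro k hk
      obtain ⟨n, hn, hkn⟩ : ∃ n ∈ N, k ∈ Metric.ball n (ε / 2) := by
        simpa only [mem_iUnion, exists_prop] using hcov hk
      refine ⟨f n, ⟨n, hn, rfl⟩, ?_⟩
      rw [edist_dist]
      refine ENNReal.ofReal_le_ofReal ?_
      rw [Metric.mem_ball] at hkn
      linarith [dist_triangle k n (f n), (hf n hn).2]

/-! ### One mesh: markers realising a labelling -/

/-- **Markers for a labelling, at one mesh.** Let `SA ⊔ SB` be a labelling of the square-lattice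
boundary of the canonical discrete domain of the Dobrushin domain `D` at mesh `δ > 0` (the boundary
`zdBoundary` depends on the domain and the mesh only, so it is read off the bare data
`⟨D.carrier, δ, ∅, ∅⟩`), with no disc of an `A`-site covered by the discs of the `B`-sites and vice
versa, `A`-sites within `ε` of `(ab) = arc 0` and `B`-sites within `ε` of `(ba) = arc 1`.  Then there
are marker sets `A, B ⊆ ℂ` within Hausdorff distance `2ε` of the two arcs whose discrete arcs are
EXACTLY `SA`, `SB`: `A =` witness points of the `A`-sites (`exists_witness_of_not_closedBall_subset`)
plus an exterior `ε`-net of `arc 0` (`exists_finite_exterior_net`), read through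
`zdDiscreteArc_eq_of_markers`. [folklore] -/
theorem exists_markers_of_labelling (D : DobrushinDomain) {δ ε : ℝ} (hδ : 0 < δ) (hε : 0 < ε)
    {SA SB : Set (Site 2)}
    (hunion : SA ∪ SB = (⟨D.carrier, δ, ∅, ∅⟩ : DiscreteDobrushin).zdBoundary)
    (hAne : SA.Nonempty) (hBne : SB.Nonempty)
    (hNFA : ∀ y ∈ SA, ¬ Metric.closedBall (meshPoint δ y)
        (Metric.infDist (meshPoint δ y) (frontier D.carrier)) ⊆
      ⋃ x ∈ SB, Metric.closedBall (meshPoint δ x) (Metric.infDist (meshPoint δ x) (frontier D.carrier)))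
    (hNFB : ∀ x ∈ SB, ¬ Metric.closedBall (meshPoint δ x)
        (Metric.infDist (meshPoint δ x) (frontier D.carrier)) ⊆
      ⋃ y ∈ SA, Metric.closedBall (meshPoint δ y) (Metric.infDist (meshPoint δ y) (frontier D.carrier)))
    (hA0 : ∀ y ∈ SA, Metric.infDist (meshPoint δ y) (D.arc 0) ≤ ε)
    (hB1 : ∀ x ∈ SB, Metric.infDist (meshPoint δ x) (D.arc 1) ≤ ε) :
    ∃ A B : Set ℂ, (⟨D.carrier, δ, A, B⟩ : DiscreteDobrushin).zdArcA = SA ∧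
      (⟨D.carrier, δ, A, B⟩ : DiscreteDobrushin).zdArcB = SB ∧
      Metric.hausdorffEDist A (D.arc 0) ≤ ENNReal.ofReal (2 * ε) ∧
      Metric.hausdorffEDist B (D.arc 1) ≤ ENNReal.ofReal (2 * ε) := by
  set E₀ : DiscreteDobrushin := ⟨D.carrier, δ, ∅, ∅⟩ with hE₀
  have hJ : (frontier D.carrier).Nonempty := D.frontier_nonempty
  have hfin : E₀.zdBoundary.Finite :=
    (meshDomain_finite D.isBounded hδ).subset E₀.zdBoundary_subset_meshDomain
  have hSAfin : SA.Finite := hfin.subset (hunion ▸ subset_union_left)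
  have hSBfin : SB.Finite := hfin.subset (hunion ▸ subset_union_right)
  have hΩ_of : ∀ x ∈ E₀.zdBoundary, meshPoint δ x ∈ D.carrier := fun x hx =>
    meshDomain_subset_meshVertices _ _ (E₀.zdBoundary_subset_meshDomain hx)
  have hSAΩ : ∀ y ∈ SA, meshPoint δ y ∈ D.carrier := fun y hy =>
    hΩ_of y (hunion ▸ Or.inl hy)
  have hSBΩ : ∀ x ∈ SB, meshPoint δ x ∈ D.carrier := fun x hx =>
    hΩ_of x (hunion ▸ Or.inr hx)
  -- witness points
  have hwA : ∀ y ∈ SA, ∃ p ∈ D.carrier, dist (meshPoint δ y) p <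
      Metric.infDist (meshPoint δ y) (frontier D.carrier) ∧ ∀ x ∈ SB,
      Metric.infDist (meshPoint δ x) (frontier D.carrier) < dist (meshPoint δ x) p := fun y hy =>
    exists_witness_of_not_closedBall_subset D.isOpen (hSAΩ y hy) hJ hSBfin (hNFA y hy)
  have hwB : ∀ x ∈ SB, ∃ p ∈ D.carrier, dist (meshPoint δ x) p <
      Metric.infDist (meshPoint δ x) (frontier D.carrier) ∧ ∀ y ∈ SA,
      Metric.infDist (meshPoint δ y) (frontier D.carrier) < dist (meshPoint δ y) p := fun x hx =>
    exists_witness_of_not_closedBall_subset D.isOpen (hSBΩ x hx) hJ hSAfin (hNFB x hx)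
  choose! pA hpA using hwA
  choose! pB hpB using hwB
  -- exterior nets
  obtain ⟨PA, hPAfin, hPAdisj, -, hPAH⟩ :=
    exists_finite_exterior_net D.toJordanDomain (D.isCompact_arc 0) (D.arc_subset_frontier 0) hε
  obtain ⟨PB, hPBfin, hPBdisj, -, hPBH⟩ :=
    exists_finite_exterior_net D.toJordanDomain (D.isCompact_arc 1) (D.arc_subset_frontier 1) hε
  set E : DiscreteDobrushin := ⟨D.carrier, δ, pA '' SA ∪ PA, pB '' SB ∪ PB⟩ with hE
  have hbdry : E.zdBoundary = SA ∪ SB := hunion.symm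
  have hnotfr : ∀ p ∈ D.carrier, p ∉ frontier D.carrier := fun p hp hpf =>
    (D.isOpen.inter_frontier_eq ▸ ⟨hp, hpf⟩ : p ∈ (∅ : Set ℂ))
  -- the discrete arcs are exactly `SA`, `SB`
  have hA : E.zdArcA = SA := by
    refine zdDiscreteArc_eq_of_markers (E := E) (hbdry ▸ subset_union_left) hSAfin hAne
      hPAfin.isCompact hPAdisj (fun s hs => hnotfr _ (hpA s hs).1) (fun s hs => (hpA s hs).2.1.le)
      fun s hs x hx hxS => (hpA s hs).2.2 x ?_
    rw [hbdry] at hx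
    exact hx.resolve_left hxS
  have hB : E.zdArcB = SB := by
    refine zdDiscreteArc_eq_of_markers (E := E) (hbdry ▸ subset_union_right) hSBfin hBne
      hPBfin.isCompact hPBdisj (fun s hs => hnotfr _ (hpB s hs).1) (fun s hs => (hpB s hs).2.1.le)
      fun s hs x hx hxS => (hpB s hs).2.2 x ?_
    rw [hbdry] at hx
    exact hx.resolve_right hxS
  -- Hausdorff bounds
  have hε2 : ENNReal.ofReal ε < ENNReal.ofReal (2 * ε) :=
    (ENNReal.ofReal_lt_ofReal_iff (by linarith)).2 (by linarith)
  have haus : ∀ (i : Fin 2) (S : Set (Site 2)) (p : Site 2 → ℂ) (P : Set ℂ),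
      (∀ s ∈ S, dist (meshPoint δ s) (p s) < Metric.infDist (meshPoint δ s) (frontier D.carrier)) →
      (∀ s ∈ S, Metric.infDist (meshPoint δ s) (D.arc i) ≤ ε) →
      Metric.hausdorffEDist P (D.arc i) ≤ ENNReal.ofReal ε →
      Metric.hausdorffEDist (p '' S ∪ P) (D.arc i) ≤ ENNReal.ofReal (2 * ε) := by
    intro i S p P hp hS hP
    have harcne : (D.arc i).Nonempty := ⟨_, D.pt_mem_arc_self i⟩
    refine Metric.hausdorffEDist_le_of_mem_edist ?_ ?_
    · rintro q (⟨s, hs, rfl⟩ | hq)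
      · obtain ⟨z, hz, hzd⟩ := (D.isCompact_arc i).exists_infDist_eq_dist harcne (meshPoint δ s)
        refine ⟨z, hz, ?_⟩
        rw [edist_dist]
        refine ENNReal.ofReal_le_ofReal ?_
        have h1 : Metric.infDist (meshPoint δ s) (frontier D.carrier) ≤
            Metric.infDist (meshPoint δ s) (D.arc i) :=
          Metric.infDist_le_infDist_of_subset (D.arc_subset_frontier i) harcne
        have h2 := hp s hs
        have h3 := hS s hs
        rw [dist_comm] at h2
        linarith [dist_triangle (p s) (meshPoint δ s) z]
      · obtain ⟨z, hz, hzd⟩ := Metric.exists_edist_lt_of_hausdorffEDist_lt hq (hP.trans_lt hε2)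
        exact ⟨z, hz, hzd.le⟩
    · intro z hz
      have hP' : Metric.hausdorffEDist (D.arc i) P < ENNReal.ofReal (2 * ε) := by
        rw [Metric.hausdorffEDist_comm]; exact hP.trans_lt hε2
      obtain ⟨q, hq, hqd⟩ := Metric.exists_edist_lt_of_hausdorffEDist_lt hz hP'
      exact ⟨q, Or.inr hq, hqd.le⟩
  exact ⟨_, _, hA, hB, haus 0 SA pA PA (fun s hs => (hpA s hs).2.1) hA0 hPAH,
    haus 1 SB pB PB (fun s hs => (hpB s hs).2.1) hB1 hPBH⟩

/-! ### The reduction: labellings at all small meshes give a discretisation family -/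

/-- **From labellings to a discretisation family (`stub_discretisable` minus its lattice heart).**
Let `D` be a Dobrushin domain and suppose that for all small meshes `δ` the square-lattice boundary
of the canonical discrete domain (read off the bare data `⟨D.carrier, δ, ∅, ∅⟩`) is labelled
`SA δ ⊔ SB δ` so that: both labels occur; no disc `closedBall (δy) (infDist (δy) ∂D)` of an `A`-site
is covered by the discs of the `B`-sites and vice versa (NECESSARY, by the forcing lemma); `A`-sites
are within `ε δ` of `arc 0` and `B`-sites within `ε δ` of `arc 1` with `ε δ → 0`; exactly two edges
of `Ω_δ` join the two label classes, each a side of exactly one inner face; and the midpoints of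
these edges converge to `{a, b}`.  Then `D` carries a `ZdDiscretisationFamily` (with data
`⟨D.carrier, δ, A δ, B δ⟩`, `exists_markers_of_labelling` at every small mesh). [folklore] -/
theorem zdDiscretisationFamily_of_labelling (D : DobrushinDomain) (SA SB : ℝ → Set (Site 2))
    (ε : ℝ → ℝ) (hε : Tendsto ε (𝓝[>] 0) (𝓝 0))
    (hlab : ∀ᶠ δ in 𝓝[>] (0 : ℝ),
      SA δ ∪ SB δ = (⟨D.carrier, δ, ∅, ∅⟩ : DiscreteDobrushin).zdBoundary ∧
      Disjoint (SA δ) (SB δ) ∧ (SA δ).Nonempty ∧ (SB δ).Nonempty ∧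
      (∀ y ∈ SA δ, ¬ Metric.closedBall (meshPoint δ y)
          (Metric.infDist (meshPoint δ y) (frontier D.carrier)) ⊆
        ⋃ x ∈ SB δ, Metric.closedBall (meshPoint δ x)
          (Metric.infDist (meshPoint δ x) (frontier D.carrier))) ∧
      (∀ x ∈ SB δ, ¬ Metric.closedBall (meshPoint δ x)
          (Metric.infDist (meshPoint δ x) (frontier D.carrier)) ⊆
        ⋃ y ∈ SA δ, Metric.closedBall (meshPoint δ y)
          (Metric.infDist (meshPoint δ y) (frontier D.carrier))) ∧
      (∀ y ∈ SA δ, Metric.infDist (meshPoint δ y) (D.arc 0) ≤ ε δ) ∧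
      (∀ x ∈ SB δ, Metric.infDist (meshPoint δ x) (D.arc 1) ≤ ε δ) ∧
      {e | e ∈ (discreteDomainGraph D.carrier δ).edgeSet ∧ (∃ x ∈ e, x ∈ SA δ) ∧
        ∃ y ∈ e, y ∈ SB δ}.ncard = 2 ∧
      ∀ e ∈ (discreteDomainGraph D.carrier δ).edgeSet, (∃ x ∈ e, x ∈ SA δ) → (∃ y ∈ e, y ∈ SB δ) →
        ∃! f, (⟨D.carrier, δ, ∅, ∅⟩ : DiscreteDobrushin).IsInnerFace f ∧ ∀ x ∈ e, IsCorner x f)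
    (hpts : Tendsto (fun δ => Metric.hausdorffEDist (medialPoint δ ''
        {e | e ∈ (discreteDomainGraph D.carrier δ).edgeSet ∧ (∃ x ∈ e, x ∈ SA δ) ∧
          ∃ y ∈ e, y ∈ SB δ}) {D.pt 0, D.pt 1}) (𝓝[>] 0) (𝓝 0)) :
    ∃ E : ℝ → DiscreteDobrushin, ZdDiscretisationFamily D E := by
  -- a positive majorant of `ε` still tending to `0`
  set ε' : ℝ → ℝ := fun δ => max (ε δ) δ with hε'
  have hε't : Tendsto ε' (𝓝[>] 0) (𝓝 0) := by
    have h2 : Tendsto (fun δ : ℝ => δ) (𝓝[>] (0 : ℝ)) (𝓝 0) :=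
      tendsto_nhdsWithin_of_tendsto_nhds tendsto_id
    simpa using hε.max h2
  have hδpos : ∀ᶠ δ in 𝓝[>] (0 : ℝ), 0 < δ := self_mem_nhdsWithin
  -- markers at every good mesh
  have key : ∀ δ : ℝ, 0 < δ →
      (SA δ ∪ SB δ = (⟨D.carrier, δ, ∅, ∅⟩ : DiscreteDobrushin).zdBoundary ∧
      Disjoint (SA δ) (SB δ) ∧ (SA δ).Nonempty ∧ (SB δ).Nonempty ∧
      (∀ y ∈ SA δ, ¬ Metric.closedBall (meshPoint δ y)
          (Metric.infDist (meshPoint δ y) (frontier D.carrier)) ⊆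
        ⋃ x ∈ SB δ, Metric.closedBall (meshPoint δ x)
          (Metric.infDist (meshPoint δ x) (frontier D.carrier))) ∧
      (∀ x ∈ SB δ, ¬ Metric.closedBall (meshPoint δ x)
          (Metric.infDist (meshPoint δ x) (frontier D.carrier)) ⊆
        ⋃ y ∈ SA δ, Metric.closedBall (meshPoint δ y)
          (Metric.infDist (meshPoint δ y) (frontier D.carrier))) ∧
      (∀ y ∈ SA δ, Metric.infDist (meshPoint δ y) (D.arc 0) ≤ ε δ) ∧
      (∀ x ∈ SB δ, Metric.infDist (meshPoint δ x) (D.arc 1) ≤ ε δ) ∧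
      {e | e ∈ (discreteDomainGraph D.carrier δ).edgeSet ∧ (∃ x ∈ e, x ∈ SA δ) ∧
        ∃ y ∈ e, y ∈ SB δ}.ncard = 2 ∧
      ∀ e ∈ (discreteDomainGraph D.carrier δ).edgeSet, (∃ x ∈ e, x ∈ SA δ) → (∃ y ∈ e, y ∈ SB δ) →
        ∃! f, (⟨D.carrier, δ, ∅, ∅⟩ : DiscreteDobrushin).IsInnerFace f ∧ ∀ x ∈ e, IsCorner x f) →
      ∃ A B : Set ℂ, (⟨D.carrier, δ, A, B⟩ : DiscreteDobrushin).zdArcA = SA δ ∧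
        (⟨D.carrier, δ, A, B⟩ : DiscreteDobrushin).zdArcB = SB δ ∧
        Metric.hausdorffEDist A (D.arc 0) ≤ ENNReal.ofReal (2 * ε' δ) ∧
        Metric.hausdorffEDist B (D.arc 1) ≤ ENNReal.ofReal (2 * ε' δ) := by
    intro δ hδ h
    obtain ⟨hunion, -, hAne, hBne, hNFA, hNFB, hA0, hB1, -, -⟩ := h
    exact exists_markers_of_labelling D hδ (lt_max_of_lt_right hδ) hunion hAne hBne hNFA hNFB
      (fun y hy => (hA0 y hy).trans (le_max_left _ _)) (fun x hx => (hB1 x hx).trans (le_max_left _ _))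
  choose! A B hAB using key
  -- on good meshes: arcs, `A`–`B` edges, admissibility
  have hgood : ∀ᶠ δ in 𝓝[>] (0 : ℝ), (⟨D.carrier, δ, A δ, B δ⟩ : DiscreteDobrushin).zdArcA = SA δ ∧
      (⟨D.carrier, δ, A δ, B δ⟩ : DiscreteDobrushin).zdArcB = SB δ ∧
      Metric.hausdorffEDist (A δ) (D.arc 0) ≤ ENNReal.ofReal (2 * ε' δ) ∧
      Metric.hausdorffEDist (B δ) (D.arc 1) ≤ ENNReal.ofReal (2 * ε' δ) ∧
      (⟨D.carrier, δ, A δ, B δ⟩ : DiscreteDobrushin).zdABEdges =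
        {e | e ∈ (discreteDomainGraph D.carrier δ).edgeSet ∧
          (∃ x ∈ e, x ∈ SA δ) ∧ ∃ y ∈ e, y ∈ SB δ} ∧
      (⟨D.carrier, δ, A δ, B δ⟩ : DiscreteDobrushin).IsZdAdmissible := by
    filter_upwards [hδpos, hlab] with δ hδ h
    obtain ⟨hA, hB, hHA, hHB⟩ := hAB δ hδ h
    obtain ⟨hunion, hdisj, hAne, hBne, -, -, -, -, hcard, hinner⟩ := h
    have hcross : (⟨D.carrier, δ, A δ, B δ⟩ : DiscreteDobrushin).zdABEdges =
        {e | e ∈ (discreteDomainGraph D.carrier δ).edgeSet ∧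
          (∃ x ∈ e, x ∈ SA δ) ∧ ∃ y ∈ e, y ∈ SB δ} := by
      ext e
      rw [DiscreteDobrushin.mem_zdABEdges_iff, hA, hB]
      rfl
    refine ⟨hA, hB, hHA, hHB, hcross, ?_⟩
    exact
      { isBounded := D.isBounded
        delta_pos := hδ
        zdArcA_nonempty := hA ▸ hAne
        zdArcB_nonempty := hB ▸ hBne
        disjoint := by rw [hA, hB]; exact hdisj
        zdBoundary_subset := by
          rw [hA, hB]
          intro x hx
          rw [hunion]
          exact hx
        ncard_zdABEdges_eq_two := by rw [hcross]; exact hcard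
        zdABEdges_inner := by
          rw [hcross]
          rintro e ⟨he, hxA, hyB⟩
          exact hinner e he hxA hyB }
  refine ⟨fun δ => ⟨D.carrier, δ, A δ, B δ⟩,
    (zdDiscretisationFamily_mk_iff D A B).2 ⟨?_, ?_, ?_, hgood.mono fun δ h => h.2.2.2.2.2⟩⟩
  · -- Hausdorff convergence of the `A`-markers: squeeze under `2 ε' → 0`
    have hup : Tendsto (fun δ => ENNReal.ofReal (2 * ε' δ)) (𝓝[>] 0) (𝓝 0) := by
      have := ENNReal.tendsto_ofReal (hε't.const_mul 2)
      simpa using this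
    refine tendsto_of_tendsto_of_tendsto_of_le_of_le' tendsto_const_nhds hup
      (Eventually.of_forall fun _ => zero_le) (hgood.mono fun δ h => h.2.2.1)
  · have hup : Tendsto (fun δ => ENNReal.ofReal (2 * ε' δ)) (𝓝[>] 0) (𝓝 0) := by
      have := ENNReal.tendsto_ofReal (hε't.const_mul 2)
      simpa using this
    refine tendsto_of_tendsto_of_tendsto_of_le_of_le' tendsto_const_nhds hup
      (Eventually.of_forall fun _ => zero_le) (hgood.mono fun δ h => h.2.2.2.1)
  · refine hpts.congr' (hgood.mono fun δ h => ?_)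
    beta_reduce
    rw [h.2.2.2.2.1]

/-! ### Registered sub-goal (one-line signature, verbatim) -/

/-- **Registered sub-goal `stub_discretisable_ofLabelling` of `stub_discretisable`**: the reduction
`zdDiscretisationFamily_of_labelling` with explicit binders — marker-free labellings of the discrete
boundary at all small meshes (sides, no forcing, two good cut edges with convergent midpoints) give a
`ZdDiscretisationFamily`. [folklore] -/
theorem stub_discretisable_ofLabelling : ∀ (D : DobrushinDomain) (SA SB : ℝ → Set (Site 2)) (ε : ℝ → ℝ), Tendsto ε (𝓝[>] 0) (𝓝 0) → (∀ᶠ δ in 𝓝[>] (0 : ℝ), SA δ ∪ SB δ = (⟨D.carrier, δ, ∅, ∅⟩ : DiscreteDobrushin).zdBoundary ∧ Disjoint (SA δ) (SB δ) ∧ (SA δ).Nonempty ∧ (SB δ).Nonempty ∧ (∀ y ∈ SA δ, ¬ Metric.closedBall (meshPoint δ y) (Metric.infDist (meshPoint δ y) (frontier D.carrier)) ⊆ ⋃ x ∈ SB δ, Metric.closedBall (meshPoint δ x) (Metric.infDist (meshPoint δ x) (frontier D.carrier))) ∧ (∀ x ∈ SB δ, ¬ Metric.closedBall (meshPoint δ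 x) (Metric.infDist (meshPoint δ x) (frontier D.carrier)) ⊆ ⋃ y ∈ SA δ, Metric.closedBall (meshPoint δ y) (Metric.infDist (meshPoint δ y) (frontier D.carrier))) ∧ (∀ y ∈ SA δ, Metric.infDist (meshPoint δ y) (D.arc 0) ≤ ε δ) ∧ (∀ x ∈ SB δ, Metric.infDist (meshPoint δ x) (D.arc 1) ≤ ε δ) ∧ {e | e ∈ (discreteDomainGraph D.carrier δ).edgeSet ∧ (∃ x ∈ e, x ∈ SA δ) ∧ ∃ y ∈ e, y ∈ SB δ}.ncard = 2 ∧ ∀ e ∈ (discreteDomainGraph D.carrier δ).edgeSet, (∃ x ∈ e, x ∈ SA δ) → (∃ y ∈ e, y ∈ SB δ) → ∃! f, (⟨D.carrier, δ, ∅, ∅⟩ : DiscreteDobrushin).IsInnerFace f ∧ ∀ x ∈ e, IsCorner x f) → Tendsto (fun δ => Metric.hausdorffEDist (medialPoint δ '' {e | e ∈ (discreteDomainGraph D.carrier δ).edgeSet ∧ (∃ x ∈ e, x ∈ SA δ) ∧ ∃ y ∈ e, y ∈ SB δ}) {D.pt 0, D.pt 1}) (𝓝[>] 0) (𝓝 0)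 → ∃ E : ℝ → DiscreteDobrushin, ZdDiscretisationFamily D E :=
  fun D SA SB ε hε hlab hpts => zdDiscretisationFamily_of_labelling D SA SB ε hε hlab hpts

end Summit.CriticalPhenomena.CardyFormulaZ2.Cruxes.LagHandOff.CrosscutDictionary

end
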